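import Mathlib
import Literature.Analysis.FluidPDE.WholeSpaceIBP
import Literature.Analysis.FluidPDE.MildSolutionProofs
import Summits.NavierStokesRegularity.NavierStokesRegularity.Theorems.RootDecompLitSliceScarLawUniform
import Summits.NavierStokesRegularity.NavierStokesRegularity.Theorems.RootDecompLitSliceClockRigidity
import HarnessLib

/-!
# Route RootDecompLitSlice — cell Uᶜ `CritTameScarIsCritical` (stmt-NavierStokesRegularity-31733):
# the (5/8)-CLOCK SUB-CELL IS CLOSED — «a first blow-up on the (5/8)-clock has critical scars»

Helper toward the Tao-vacuous cell Uᶜ (`--supports 31733`; no item, no node, no registered stub).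
The open content of Uᶜ is the clock window `b ∈ [1/2, 2/3)`: the landed one-window law
`ClockScarLaw.uniformClockScarRung` gives scars `∫_{B_r}|u(T)|² ≤ C r^{4b/(b+2)}`, critical
exactly for `b ≥ 2/3` (`TwoThirdsTameScarIsCritical.twoThirdsClockCell`). ONE bootstrap step
through the uniform scar law `LocalEnergyBudget.scar_le_uniform` (landed: localised energy budget
with the Laplacian, cubic-flux and global-pressure flux numbers all discharged) lowers the
threshold: with the scales `r = s²⁰⁰`, window `τ = s³²⁰`, cutoff radius `ρ = s⁴²`, the base law
`∫_{B_{3ρ}}|u(T)|² ≤ C ρ^{20/21} = C s⁴⁰` at `b = 5/8` and the clock level `H = K s²⁰⁰`, every term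
of the budget is `≤ const · s^{k}` with `k ∈ {200, 200, 280, 356, 223, 203, 356} ≥ 200`
(window level, release cross term, release level, Laplacian, cubic flux, pressure flux, mean
part) — the exponent bookkeeping `a' = min(γb, 2−γ+γb/2+θα/2, 2−θ(1−α/4)−¾γ(1−b/2), …) ≥ 1` at
`(b, α, γ, θ) = (5/8, 20/21, 8/5, 21/100)`.

* `ClockThreshold.exists_centredCutoff` — smooth cutoffs `= 1` on `B(x₀,ρ)`, supported in
  `B(x₀,3ρ)`, `|∇φ| ≤ C/ρ`, `|Δφ| ≤ C/ρ²` (tree `cutoff`, `exists_norm_fderiv_cutoff_le`,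
  `exists_abs_laplacian_cutoff_le`, translated);
* ★ `ClockThreshold.uniformScar_of_clock_fiveEighths` — on U's frame with the (5/8)-clock:
  `∃ M r₁ > 0, ∀ x₀, ∀ r < r₁, ∫_{B(x₀,r)}|u(T)|² ≤ M r` (uniform in the centre);
* ★ `ClockThreshold.fiveEighthsClockCell` — U's frame and U's conclusion VERBATIM plus the
  (5/8)-clock: the literal sub-cell `b = 5/8` (hence every `b ≥ 5/8`) of U/Uᶜ is a theorem; the open
  clock window of Uᶜ shrinks from `[1/2, 2/3)` to `[1/2, 5/8)`.

HONEST FRAMING: helper lemmas INSIDE the Tao-vacuous cell Uᶜ; zero load of the route moves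
(ROOT ⟺ U ∧ P1, critic rows 354/371/563/639/665/678); no item is re-typed; the (5/8)-cell is an
ASIDE-kind rung (named-rung rule), not the item `CritTameScarIsCritical` (`b = 1/2`), which the
crude (global-pressure) tier provably cannot reach (one-step threshold `b₁ ≈ 0.6226`, iterated
`b_c ≈ 0.6207`, numerics `folder/sigma/crude_lp.py`). Rung 0: nothing here proves NS regularity.
Decomp-ns route-writer g40. [cite: CaffarelliKohnNirenberg1982, §2 eq. (2.4)]
-/

set_option linter.dupNamespace false

noncomputable section

namespace Summit.NavierStokesRegularity.NavierStokesRegularity.Theorems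

open MeasureTheory TopologicalSpace Set Function Filter Metric
open _root_.Topology
open scoped Laplacian InnerProductSpace RealInnerProductSpace ENNReal NNReal ContDiff
open Literature.Analysis.FluidPDE

namespace ClockThreshold

/-- **Centred cutoffs with scale-invariant bounds**: absolute `C_∇, C_Δ ≥ 0` such that for every
centre `x₀` and radius `ρ > 0` there is a smooth compactly supported `φ`, `0 ≤ φ ≤ 1`, `φ = 1` on
`B(x₀,ρ)`, `tsupport φ ⊆ B(x₀,3ρ)`, `‖∇φ‖ ≤ C_∇/ρ`, `|Δφ| ≤ C_Δ/ρ²` (the tree cutoff `cutoff ρ`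
translated to `x₀`). [folklore] -/
theorem exists_centredCutoff : ∃ Cg CL : ℝ, 0 ≤ Cg ∧ 0 ≤ CL ∧
    ∀ (x₀ : EuclideanSpace ℝ (Fin 3)) (ρ : ℝ), 0 < ρ →
      ∃ φ : EuclideanSpace ℝ (Fin 3) → ℝ, ContDiff ℝ ∞ φ ∧ HasCompactSupport φ ∧
        (∀ x, 0 ≤ φ x) ∧ (∀ x, φ x ≤ 1) ∧ (∀ x ∈ ball x₀ ρ, φ x = 1) ∧
        tsupport φ ⊆ ball x₀ (3 * ρ) ∧ (∀ x, ‖fderiv ℝ φ x‖ ≤ Cg / ρ) ∧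
        (∀ x, |(Δ φ) x| ≤ CL / ρ ^ 2) := by
  obtain ⟨Cg, hCg, hg⟩ := exists_norm_fderiv_cutoff_le (E := EuclideanSpace ℝ (Fin 3))
  obtain ⟨CL, hCL, hL⟩ := exists_abs_laplacian_cutoff_le (E := EuclideanSpace ℝ (Fin 3))
  refine ⟨Cg, CL, hCg, hCL, fun x₀ ρ hρ => ⟨fun x => cutoff ρ (x - x₀), ?_, ?_, ?_, ?_, ?_, ?_, ?_, ?_⟩⟩
  · exact (contDiff_cutoff (n := ⊤) ρ).comp (contDiff_id.sub contDiff_const)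
  · exact (hasCompactSupport_cutoff hρ).comp_homeomorph (Homeomorph.subRight x₀)
  · exact fun x => cutoff_nonneg _ _
  · exact fun x => cutoff_le_one _ _
  · intro x hx
    rw [mem_ball, dist_eq_norm] at hx
    exact cutoff_eq_one hρ hx.le
  · have hsub : support (fun x : EuclideanSpace ℝ (Fin 3) => cutoff ρ (x - x₀)) ⊆
        closedBall x₀ (2 * ρ) := fun x hx => by
      rw [mem_closedBall, dist_eq_norm]
      by_contra h
      exact hx (cutoff_eq_zero hρ (not_le.1 h).le)
    exact (closure_minimal hsub isClosed_closedBall).trans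
      (closedBall_subset_ball (by linarith))
  · intro x
    rw [fderiv_comp_sub]
    exact hg ρ hρ _
  · intro x
    have : (Δ fun y : EuclideanSpace ℝ (Fin 3) => cutoff ρ (y - x₀)) x =
        (Δ (cutoff ρ : EuclideanSpace ℝ (Fin 3) → ℝ)) (x - x₀) := by
      rw [InnerProductSpace.laplacian_eq_iteratedFDeriv_stdOrthonormalBasis,
        InnerProductSpace.laplacian_eq_iteratedFDeriv_stdOrthonormalBasis]
      simp only [sub_eq_add_neg, iteratedFDeriv_comp_add_right]
    rw [this]
    exact hL ρ hρ _

set_option maxHeartbeats 1600000 in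
/-- ★ **Uniform critical scars on the (5/8)-clock.** Frame: `ν > 0`, classical on `[0,T) × ℝ³`,
Leray–Hopf on `[0,T]` from decaying data, and the (5/8)-clock `‖u(t) − u(T)‖₂² ≤ K (T−t)^{5/8}`
near `T`. Then `∫_{B(x₀,r)}|u(T)|² ≤ M r` for all centres `x₀` and all `r < r₁` — ONE bootstrap
step (uniform scar law `LocalEnergyBudget.scar_le_uniform` at the scales `r = s²⁰⁰, τ = s³²⁰,
ρ = s⁴²`) from the base law `ClockScarLaw.uniformClockScarRung` (`α₀ = 20/21`).
[cite: CaffarelliKohnNirenberg1982, §2 eq. (2.4)] -/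
theorem uniformScar_of_clock_fiveEighths :
    ∀ (ν T : ℝ), 0 < ν → 0 < T →
    ∀ (u : ℝ → EuclideanSpace ℝ (Fin 3) → EuclideanSpace ℝ (Fin 3))
      (p : ℝ → EuclideanSpace ℝ (Fin 3) → ℝ),
      IsClassicalNSSolutionOn (Set.Ico 0 T) ν 0 u p →
      IsLerayHopfOn T ν 0 (u 0) u →
      HasRapidSpatialDecay (u 0) →
      (∃ K T₁ : ℝ, T₁ < T ∧ ∀ t ∈ Set.Ioo T₁ T,
        ∫⁻ x, ‖u t x - u T x‖ₑ ^ 2 ≤ ENNReal.ofReal (K * (T - t) ^ (5 / 8 : ℝ))) →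
      ∃ M r₁ : ℝ, 0 < r₁ ∧ ∀ (x₀ : EuclideanSpace ℝ (Fin 3)), ∀ r ∈ Set.Ioo 0 r₁,
        ∫ x in ball x₀ r, ‖u T x‖ ^ 2 ≤ M * r := by
  intro ν T hν hT u p hcl hLH hdec hclock
  -- the base law `α₀ = 20/21`
  obtain ⟨C₁, R₁, hR₁, hbase⟩ := ClockScarLaw.uniformClockScarRung (b := 5 / 8) (by norm_num)
    (by norm_num) ν T hν hT u p hcl hLH hdec hclock
  obtain ⟨K, T₁, hT₁, hK⟩ := hclock
  obtain ⟨c₀, K₀, K₁, hc₀, hK₀, hK₁, hU⟩ := LocalEnergyBudget.scar_le_uniform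
  obtain ⟨Cg, CL, hCg, hCL, hcut⟩ := exists_centredCutoff
  set K' : ℝ := max K 0 with hK'def
  have hK'0 : 0 ≤ K' := le_max_right _ _
  set C₁' : ℝ := max C₁ 0 with hC₁'def
  have hC₁'0 : 0 ≤ C₁' := le_max_right _ _
  set E : ℝ := ∫ x, ‖u 0 x‖ ^ 2 with hEdef
  have hE0 : 0 ≤ E := integral_nonneg fun x => by positivity
  set D : ℝ := 2 * K' + 2 * (C₁' * (3 : ℝ) ^ (20 / 21 : ℝ)) with hDdef
  have hD0 : 0 ≤ D := by positivity
  set Gc : ℝ := Real.sqrt E * Real.sqrt K' / ν with hGcdef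
  have hGc0 : 0 ≤ Gc := by positivity
  set M : ℝ := 2 * K' + 32 * K' / ν + 32 * Real.sqrt K' * Real.sqrt D / ν + 8 * CL * D +
    8 * Cg * K₀ / ν * D ^ (3 / 4 : ℝ) * Gc ^ (3 / 4 : ℝ) +
    16 * Cg * K₁ * Real.sqrt E / ν * D ^ (1 / 4 : ℝ) * Gc ^ (3 / 4 : ℝ) + c₀ * (K' + C₁') with hMdef
  -- the admissible scale `s₁`
  set s₁ : ℝ := min (1 / 4) (min (R₁ / 3) (min (T - T₁) T)) with hs₁def
  have hs₁0 : 0 < s₁ := lt_min (by norm_num) (lt_min (by positivity) (lt_min (sub_pos.2 hT₁) hT))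
  have hs₁4 : s₁ ≤ 1 / 4 := min_le_left _ _
  have hs₁R : s₁ ≤ R₁ / 3 := (min_le_right _ _).trans (min_le_left _ _)
  have hs₁T₁ : s₁ ≤ T - T₁ := (min_le_right _ _).trans ((min_le_right _ _).trans (min_le_left _ _))
  have hs₁T : s₁ ≤ T := (min_le_right _ _).trans ((min_le_right _ _).trans (min_le_right _ _))
  refine ⟨M, s₁ ^ 200, by positivity, fun x₀ r hr => ?_⟩
  have hr0 : 0 < r := hr.1
  -- the basic scale `s = r^{1/200}`
  set s : ℝ := r ^ (1 / 200 : ℝ) with hsdef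
  have hs0 : 0 < s := Real.rpow_pos_of_pos hr0 _
  have hsp : ∀ (n m : ℕ) (e : ℝ), (n : ℝ) * e = m → (s ^ n) ^ e = s ^ m := by
    intro n m e h
    rw [← Real.rpow_natCast s n, ← Real.rpow_mul hs0.le, h, Real.rpow_natCast]
  have hs200 : s ^ 200 = r := by
    rw [hsdef, ← Real.rpow_natCast, ← Real.rpow_mul hr0.le]; norm_num
  have hss₁ : s < s₁ := by
    have h1 : r ^ (1 / 200 : ℝ) < (s₁ ^ 200) ^ (1 / 200 : ℝ) :=
      Real.rpow_lt_rpow hr0.le hr.2 (by norm_num)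
    rwa [← Real.rpow_natCast s₁ 200, ← Real.rpow_mul hs₁0.le,
      show ((200 : ℕ) : ℝ) * (1 / 200 : ℝ) = 1 by norm_num, Real.rpow_one] at h1
  have hs4 : s ≤ 1 / 4 := hss₁.le.trans hs₁4
  have hs1 : s ≤ 1 := hs4.trans (by norm_num)
  have hsle : ∀ {n m : ℕ}, m ≤ n → s ^ n ≤ s ^ m := fun h => pow_le_pow_of_le_one hs0.le hs1 h
  have hspow1 : ∀ {n : ℕ}, n ≠ 0 → s ^ n ≤ s := fun h => pow_le_of_le_one hs0.le hs1 h
  -- the scales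
  set τ : ℝ := s ^ 320 with hτdef
  set ρ : ℝ := s ^ 42 with hρdef
  have hτ0 : 0 < τ := by positivity
  have hρ0 : 0 < ρ := by positivity
  have hτT₁ : τ < T - T₁ := lt_of_le_of_lt (hspow1 (by norm_num)) (hss₁.trans_le hs₁T₁)
  have hτT : τ < T := lt_of_le_of_lt (hspow1 (by norm_num)) (hss₁.trans_le hs₁T)
  have hρR₁ : 3 * ρ < R₁ := by
    have : ρ ≤ s := hspow1 (by norm_num)
    linarith [hss₁.trans_le hs₁R]
  have hρR₁' : ρ < R₁ := by linarith
  have h4r : 4 * s ^ 200 ≤ ρ := by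
    have h1 : s ^ 158 ≤ 1 / 4 := (hspow1 (by norm_num)).trans hs4
    calc 4 * s ^ 200 = s ^ 42 * (4 * s ^ 158) := by ring
      _ ≤ s ^ 42 * 1 := mul_le_mul_of_nonneg_left (by linarith) (pow_pos hs0 42).le
      _ = ρ := by rw [hρdef, mul_one]
  -- the clock level on the window
  set H : ℝ := K' * s ^ 200 with hHdef
  have hH0 : 0 ≤ H := by positivity
  have hmod : ∀ t ∈ Set.Ico (T - τ) T, ∫⁻ x, ‖u t x - u T x‖ₑ ^ 2 ≤ ENNReal.ofReal H := by
    intro t ht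
    have htT₁ : T₁ < t := by linarith [ht.1]
    have h0t : 0 ≤ T - t := by linarith [ht.2]
    refine (hK t ⟨htT₁, ht.2⟩).trans (ENNReal.ofReal_le_ofReal ?_)
    have h1 : (T - t) ^ (5 / 8 : ℝ) ≤ τ ^ (5 / 8 : ℝ) :=
      Real.rpow_le_rpow h0t (by linarith [ht.1]) (by norm_num)
    have h2 : τ ^ (5 / 8 : ℝ) = s ^ 200 := hsp 320 200 _ (by norm_num)
    calc K * (T - t) ^ (5 / 8 : ℝ) ≤ K' * (T - t) ^ (5 / 8 : ℝ) :=
          mul_le_mul_of_nonneg_right (le_max_left _ _) (Real.rpow_nonneg h0t _)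
      _ ≤ K' * τ ^ (5 / 8 : ℝ) := mul_le_mul_of_nonneg_left h1 hK'0
      _ = H := by rw [h2]
  -- the cutoff
  obtain ⟨φ, hφ, hφc, hφ0, hφ1, hone, hsupp, hDφ, hΔφ⟩ := hcut x₀ ρ hρ0
  -- THE UNIFORM SCAR LAW at these scales
  have hINEQ := hU ν T hν hT u p hcl hLH hdec x₀ (s ^ 200) ρ (3 * ρ) τ H (by positivity) h4r hτ0
    hτT hH0 hmod φ (Cg / ρ) (CL / ρ ^ 2) hφ hφc hφ0 hφ1 hone hsupp hDφ hΔφ (by positivity)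
  -- the base law at `3ρ` and at `ρ`
  set m3 : ℝ := ∫ x in ball x₀ (3 * ρ), ‖u T x‖ ^ 2 with hm3
  set mρ : ℝ := ∫ x in ball x₀ ρ, ‖u T x‖ ^ 2 with hmρ
  have hm3_0 : 0 ≤ m3 := integral_nonneg fun x => by positivity
  have hmρ_0 : 0 ≤ mρ := integral_nonneg fun x => by positivity
  have hexp : (4 * (5 / 8 : ℝ) / (5 / 8 + 2)) = 20 / 21 := by norm_num
  have hρpow : ρ ^ (20 / 21 : ℝ) = s ^ 40 := hsp 42 40 _ (by norm_num)
  have hm3le : m3 ≤ C₁' * (3 : ℝ) ^ (20 / 21 : ℝ) * s ^ 40 := by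
    have h1 := hbase x₀ (3 * ρ) ⟨by positivity, hρR₁⟩
    rw [hexp, Real.mul_rpow (by norm_num) hρ0.le, hρpow] at h1
    refine h1.trans ?_
    have : C₁ * ((3 : ℝ) ^ (20 / 21 : ℝ) * s ^ 40) ≤ C₁' * ((3 : ℝ) ^ (20 / 21 : ℝ) * s ^ 40) :=
      mul_le_mul_of_nonneg_right (le_max_left _ _) (by positivity)
    linarith
  have hmρle : mρ ≤ C₁' * s ^ 40 := by
    have h1 := hbase x₀ ρ ⟨hρ0, hρR₁'⟩
    rw [hexp, hρpow] at h1
    exact h1.trans (mul_le_mul_of_nonneg_right (le_max_left _ _) (by positivity))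
  -- the window quantities
  have hsqrtH : Real.sqrt H = Real.sqrt K' * s ^ 100 := by
    rw [hHdef, show s ^ 200 = (s ^ 100) ^ 2 by ring, Real.sqrt_mul' _ (sq_nonneg _),
      Real.sqrt_sq (by positivity)]
  have hp200_40 : s ^ 200 ≤ s ^ 40 := hsle (by norm_num)
  have hHle : H ≤ K' * s ^ 40 := by
    rw [hHdef]; exact mul_le_mul_of_nonneg_left hp200_40 hK'0
  have h2Hm : 2 * H + 2 * m3 ≤ D * s ^ 40 := by
    calc 2 * H + 2 * m3 ≤ 2 * (K' * s ^ 40) + 2 * (C₁' * (3 : ℝ) ^ (20 / 21 : ℝ) * s ^ 40) :=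
          add_le_add (by linarith) (by linarith)
      _ = D * s ^ 40 := by rw [hDdef]; ring
  set A : ℝ := (Real.sqrt H + Real.sqrt m3) ^ 2 with hAdef
  have hA0 : 0 ≤ A := sq_nonneg _
  have hAle : A ≤ D * s ^ 40 := by
    have h1 : A ≤ 2 * H + 2 * m3 := by
      rw [hAdef]
      nlinarith [sq_nonneg (Real.sqrt H - Real.sqrt m3), Real.sq_sqrt hH0, Real.sq_sqrt hm3_0]
    exact h1.trans h2Hm
  have hA34 : A ^ (3 / 4 : ℝ) ≤ D ^ (3 / 4 : ℝ) * s ^ 30 := by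
    calc A ^ (3 / 4 : ℝ) ≤ (D * s ^ 40) ^ (3 / 4 : ℝ) := Real.rpow_le_rpow hA0 hAle (by norm_num)
      _ = D ^ (3 / 4 : ℝ) * s ^ 30 := by
          rw [Real.mul_rpow hD0 (by positivity), hsp 40 30 _ (by norm_num)]
  have hA14 : A ^ (1 / 4 : ℝ) ≤ D ^ (1 / 4 : ℝ) * s ^ 10 := by
    calc A ^ (1 / 4 : ℝ) ≤ (D * s ^ 40) ^ (1 / 4 : ℝ) := Real.rpow_le_rpow hA0 hAle (by norm_num)
      _ = D ^ (1 / 4 : ℝ) * s ^ 10 := by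
          rw [Real.mul_rpow hD0 (by positivity), hsp 40 10 _ (by norm_num)]
  have hsqrt2 : Real.sqrt (2 * H + 2 * m3) ≤ Real.sqrt D * s ^ 20 := by
    calc Real.sqrt (2 * H + 2 * m3) ≤ Real.sqrt (D * (s ^ 20) ^ 2) :=
          Real.sqrt_le_sqrt (by rw [show (s ^ 20) ^ 2 = s ^ 40 by ring]; exact h2Hm)
      _ = Real.sqrt D * s ^ 20 := by rw [Real.sqrt_mul' _ (sq_nonneg _), Real.sqrt_sq (by positivity)]
  have hG : Real.sqrt E * Real.sqrt H / ν = Gc * s ^ 100 := by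
    rw [hsqrtH, hGcdef]; ring
  have hG34 : (Real.sqrt E * Real.sqrt H / ν) ^ (3 / 4 : ℝ) = Gc ^ (3 / 4 : ℝ) * s ^ 75 := by
    rw [hG, Real.mul_rpow hGc0 (by positivity), hsp 100 75 _ (by norm_num)]
  have hτ14 : τ ^ (1 / 4 : ℝ) = s ^ 80 := hsp 320 80 _ (by norm_num)
  have hν0 : ν ≠ 0 := hν.ne'
  have hs0' : s ≠ 0 := hs0.ne'
  -- TERM BY TERM
  -- (1) window level
  have hT1 : 2 * H = 2 * K' * s ^ 200 := by rw [hHdef]; ring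
  -- (2) release
  have hT2 : 16 * ((s ^ 200) ^ 2 / (ν * τ)) *
      ((4 * H + 4 * Real.sqrt H * Real.sqrt (2 * H + 2 * m3)) / 2) ≤
      32 * K' / ν * s ^ 280 + 32 * Real.sqrt K' * Real.sqrt D / ν * s ^ 200 := by
    have e : 16 * ((s ^ 200) ^ 2 / (ν * τ)) *
        ((4 * H + 4 * Real.sqrt H * Real.sqrt (2 * H + 2 * m3)) / 2) =
        32 * K' / ν * s ^ 280 +
          32 * Real.sqrt K' / ν * s ^ 180 * Real.sqrt (2 * H + 2 * m3) := by
      rw [hsqrtH, hHdef, hτdef]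
      field_simp
      ring
    rw [e]
    have h1 : 32 * Real.sqrt K' / ν * s ^ 180 * Real.sqrt (2 * H + 2 * m3) ≤
        32 * Real.sqrt K' / ν * s ^ 180 * (Real.sqrt D * s ^ 20) :=
      mul_le_mul_of_nonneg_left hsqrt2 (by positivity)
    have h2 : 32 * Real.sqrt K' / ν * s ^ 180 * (Real.sqrt D * s ^ 20) =
        32 * Real.sqrt K' * Real.sqrt D / ν * s ^ 200 := by ring
    linarith
  -- (3) Laplacian
  have hT3 : 16 * ((s ^ 200) ^ 2 / (ν * τ)) * ((ν * (CL / ρ ^ 2) * A * τ) / 2) ≤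
      8 * CL * D * s ^ 356 := by
    have e : 16 * ((s ^ 200) ^ 2 / (ν * τ)) * ((ν * (CL / ρ ^ 2) * A * τ) / 2) =
        8 * CL * s ^ 316 * A := by
      rw [hτdef, hρdef]
      field_simp
      ring
    rw [e]
    calc 8 * CL * s ^ 316 * A ≤ 8 * CL * s ^ 316 * (D * s ^ 40) :=
          mul_le_mul_of_nonneg_left hAle (by positivity)
      _ = 8 * CL * D * s ^ 356 := by ring
  -- (4) cubic flux
  have hT4 : 16 * ((s ^ 200) ^ 2 / (ν * τ)) *
      ((Cg / ρ * (K₀ * A ^ (3 / 4 : ℝ) * (τ ^ (1 / 4 : ℝ) *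
        (Real.sqrt E * Real.sqrt H / ν) ^ (3 / 4 : ℝ)))) / 2) ≤
      8 * Cg * K₀ / ν * D ^ (3 / 4 : ℝ) * Gc ^ (3 / 4 : ℝ) * s ^ 223 := by
    rw [hτ14, hG34]
    have e : 16 * ((s ^ 200) ^ 2 / (ν * τ)) *
        ((Cg / ρ * (K₀ * A ^ (3 / 4 : ℝ) * (s ^ 80 * (Gc ^ (3 / 4 : ℝ) * s ^ 75)))) / 2) =
        8 * Cg * K₀ / ν * Gc ^ (3 / 4 : ℝ) * s ^ 193 * A ^ (3 / 4 : ℝ) := by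
      rw [hτdef, hρdef]
      field_simp
      try ring
    rw [e]
    calc 8 * Cg * K₀ / ν * Gc ^ (3 / 4 : ℝ) * s ^ 193 * A ^ (3 / 4 : ℝ)
        ≤ 8 * Cg * K₀ / ν * Gc ^ (3 / 4 : ℝ) * s ^ 193 * (D ^ (3 / 4 : ℝ) * s ^ 30) :=
          mul_le_mul_of_nonneg_left hA34 (by positivity)
      _ = 8 * Cg * K₀ / ν * D ^ (3 / 4 : ℝ) * Gc ^ (3 / 4 : ℝ) * s ^ 223 := by ring
  -- (5) pressure flux
  have hT5 : 16 * ((s ^ 200) ^ 2 / (ν * τ)) *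
      ((2 * (Cg / ρ) * (K₁ * Real.sqrt E * A ^ (1 / 4 : ℝ) * (τ ^ (1 / 4 : ℝ) *
        (Real.sqrt E * Real.sqrt H / ν) ^ (3 / 4 : ℝ)))) / 2) ≤
      16 * Cg * K₁ * Real.sqrt E / ν * D ^ (1 / 4 : ℝ) * Gc ^ (3 / 4 : ℝ) * s ^ 203 := by
    rw [hτ14, hG34]
    have e : 16 * ((s ^ 200) ^ 2 / (ν * τ)) *
        ((2 * (Cg / ρ) * (K₁ * Real.sqrt E * A ^ (1 / 4 : ℝ) *
          (s ^ 80 * (Gc ^ (3 / 4 : ℝ) * s ^ 75)))) / 2) =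
        16 * Cg * K₁ * Real.sqrt E / ν * Gc ^ (3 / 4 : ℝ) * s ^ 193 * A ^ (1 / 4 : ℝ) := by
      rw [hτdef, hρdef]
      field_simp
      try ring
    rw [e]
    calc 16 * Cg * K₁ * Real.sqrt E / ν * Gc ^ (3 / 4 : ℝ) * s ^ 193 * A ^ (1 / 4 : ℝ)
        ≤ 16 * Cg * K₁ * Real.sqrt E / ν * Gc ^ (3 / 4 : ℝ) * s ^ 193 * (D ^ (1 / 4 : ℝ) * s ^ 10) :=
          mul_le_mul_of_nonneg_left hA14 (by positivity)
      _ = 16 * Cg * K₁ * Real.sqrt E / ν * D ^ (1 / 4 : ℝ) * Gc ^ (3 / 4 : ℝ) * s ^ 203 := by ring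
  -- (6) mean part
  have hT6 : c₀ * (s ^ 200 / ρ) ^ 2 * (H + mρ) ≤ c₀ * (K' + C₁') * s ^ 356 := by
    have e : c₀ * (s ^ 200 / ρ) ^ 2 * (H + mρ) = c₀ * s ^ 316 * (H + mρ) := by
      rw [hρdef]
      field_simp
      try ring
    rw [e]
    have h1 : H + mρ ≤ (K' + C₁') * s ^ 40 := by
      calc H + mρ ≤ K' * s ^ 40 + C₁' * s ^ 40 := add_le_add hHle hmρle
        _ = (K' + C₁') * s ^ 40 := by ring
    calc c₀ * s ^ 316 * (H + mρ) ≤ c₀ * s ^ 316 * ((K' + C₁') * s ^ 40) :=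
          mul_le_mul_of_nonneg_left h1 (by positivity)
      _ = c₀ * (K' + C₁') * s ^ 356 := by ring
  -- powers of `s` down to `s^200`
  have hp280 : s ^ 280 ≤ s ^ 200 := hsle (by norm_num)
  have hp356 : s ^ 356 ≤ s ^ 200 := hsle (by norm_num)
  have hp223 : s ^ 223 ≤ s ^ 200 := hsle (by norm_num)
  have hp203 : s ^ 203 ≤ s ^ 200 := hsle (by norm_num)
  -- assemble
  have hsplit : ∀ (P X Y Z W V : ℝ), P * ((X + (Y + Z + W)) / 2) + V =
      P * (X / 2) + P * (Y / 2) + P * (Z / 2) + P * (W / 2) + V := fun P X Y Z W V => by ring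
  rw [← hs200]
  refine hINEQ.trans ?_
  rw [add_assoc, hsplit]
  have c2 : 0 ≤ 32 * K' / ν := by positivity
  have c3 : 0 ≤ 8 * CL * D := by positivity
  have c4 : 0 ≤ 8 * Cg * K₀ / ν * D ^ (3 / 4 : ℝ) * Gc ^ (3 / 4 : ℝ) := by positivity
  have c5 : 0 ≤ 16 * Cg * K₁ * Real.sqrt E / ν * D ^ (1 / 4 : ℝ) * Gc ^ (3 / 4 : ℝ) := by
    positivity
  have c6 : 0 ≤ c₀ * (K' + C₁') := by positivity
  have hMs : M * s ^ 200 = 2 * K' * s ^ 200 + ((32 * K' / ν * s ^ 200 +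
      32 * Real.sqrt K' * Real.sqrt D / ν * s ^ 200) + 8 * CL * D * s ^ 200 +
      8 * Cg * K₀ / ν * D ^ (3 / 4 : ℝ) * Gc ^ (3 / 4 : ℝ) * s ^ 200 +
      16 * Cg * K₁ * Real.sqrt E / ν * D ^ (1 / 4 : ℝ) * Gc ^ (3 / 4 : ℝ) * s ^ 200 +
      c₀ * (K' + C₁') * s ^ 200) := by rw [hMdef]; ring
  rw [hMs]
  gcongr ?_ + (?_ + ?_ + ?_ + ?_ + ?_)
  · exact le_of_eq hT1
  · exact hT2.trans (add_le_add (mul_le_mul_of_nonneg_left hp280 c2) le_rfl)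
  · exact hT3.trans (mul_le_mul_of_nonneg_left hp356 c3)
  · exact hT4.trans (mul_le_mul_of_nonneg_left hp223 c4)
  · exact hT5.trans (mul_le_mul_of_nonneg_left hp203 c5)
  · exact hT6.trans (mul_le_mul_of_nonneg_left hp356 c6)

/-- ★ **THE (5/8)-CLOCK SUB-CELL OF U/Uᶜ IS CLOSED.** U's frame — maximal smooth solution,
Leray–Hopf on `[0,T]`, rapidly decaying datum, `L²`-tame at `T` — and U's conclusion VERBATIM,
plus the (5/8)-clock hypothesis (any `b`-clock with `b ≥ 5/8` is a (5/8)-clock near `T`). The open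
clock window of the Tao-vacuous cell Uᶜ shrinks from `[1/2, 2/3)` (tree
`TwoThirdsTameScarIsCritical.twoThirdsClockCell`) to `[1/2, 5/8)`.
[cite: CaffarelliKohnNirenberg1982, §2 eq. (2.4)] -/
theorem fiveEighthsClockCell :
    ∀ (ν T : ℝ), 0 < ν → 0 < T →
    ∀ (u : ℝ → EuclideanSpace ℝ (Fin 3) → EuclideanSpace ℝ (Fin 3))
      (p : ℝ → EuclideanSpace ℝ (Fin 3) → ℝ),
      IsMaximalSmoothSolution ν 0 u p T →
      IsLerayHopfOn T ν 0 (u 0) u →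
      HasRapidSpatialDecay (u 0) →
      Filter.Tendsto (fun t => eLpNorm (u t - u T) 2 volume) (nhdsWithin T (Set.Iio T)) (nhds 0) →
      (∃ K T₁ : ℝ, T₁ < T ∧ ∀ t ∈ Set.Ioo T₁ T,
        ∫⁻ x, ‖u t x - u T x‖ₑ ^ 2 ≤ ENNReal.ofReal (K * (T - t) ^ (5 / 8 : ℝ))) →
      ∀ x₀ : EuclideanSpace ℝ (Fin 3), ∃ M r₁ : ℝ, 0 < r₁ ∧ ∀ r ∈ Set.Ioo 0 r₁,
        r⁻¹ * ∫ x in ball x₀ r, ‖u T x‖ ^ 2 ≤ M := by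
  intro ν T hν hT u p hmax hLH hdec _ hclock x₀
  obtain ⟨M, r₁, hr₁, hM⟩ := uniformScar_of_clock_fiveEighths ν T hν hT u p hmax.1 hLH hdec hclock
  refine ⟨M, r₁, hr₁, fun r hr => ?_⟩
  exact (inv_mul_le_iff₀ hr.1).2 ((hM x₀ r hr).trans (le_of_eq (mul_comm M r)))

end ClockThreshold

end Summit.NavierStokesRegularity.NavierStokesRegularity.Theorems

end
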